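import Literature.AlgebraicGeometry.HodgeTheory.FermatHodgeCharacterCriterion
import HarnessLib

/-!
# The Hodge condition at a conductor `f`, `3 ∤ f`, met at the exact levels `f`, `3f` — Aoki 1983, Prop. 2.2

Topic `Literature/AlgebraicGeometry/HodgeTheory`. THEOREMS only (no definition, no named fact, no `sorry`).
Support file (XXIII), the abstract-conductor form of `IsHodge.rel_third_level` (`FermatHodgeCharacterSubLevel`,
which is the top case `m = 3f`) and the `3`-analogue of `FermatHodgeCharacterExactLevel` (XVIII: levels `f`, `2f`,
Euler factor `1 - χ(2)`): here the levels meeting the conductor `f` are `f` and `3f`, the level `3f` carries the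
Euler factor `1 - χ(3)` and HALF the weight of the level `f` (`φ(3f) = 2φ(f)` for `3 ∤ f`). This is the relation
behind [Aoki1983, Thm. C] §9 (V) at an odd level `m` divisible by `3` when the largest exact level `F = m/d₀` has
`3 ∥ F` ("`τ_{3d₀}`", the second alternative `v₋₁` of [Aoki1983, Prop. 6.1] for `U(F)`), route K₉ of the cell's
scoping document.

For a Hodge character `α : Fin r → ℤ/m`, `αᵢ = (m/Mᵢ) wᵢ` (`Mᵢ ∣ m` the exact level, `wᵢ` a unit mod `Mᵢ`),
`f ∣ m` with `3 ∤ f` such that every `Mᵢ` divisible by `f` is `f` or `3f`, and an odd primitive character `χ`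
mod `f` — **`IsHodge.rel_third_conductor_conj`** —
`∑_{Mᵢ = 3f} (1 - conj χ(3)) χ(w̄ᵢ) + 2 ∑_{Mᵢ = f} χ(w̄ᵢ) = 0` (`w̄ᵢ = wᵢ mod f`; complex conjugate form).

HONEST FRAMING (cell `pub-hfermat`): explicit algebraic cycles for specific Hodge classes on
Fermat/Delsarte varieties; residual open instances listed; no claim on general Hodge. (Surface
classes are algebraic by Lefschetz (1,1); this file is a relation among Hodge characters, no case
of HC.)

## References
* [Aoki1983] N. Aoki, *On some arithmetic problems related to the Hodge cycles on the Fermat varieties*,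
  Math. Ann. 266 (1983) 23–54 — Props. 2.1, 2.2 (pp. 28–29), Prop. 6.1, §9 (V) pp. 52–54.
-/

noncomputable section

open Finset

namespace Literature.AlgebraicGeometry.HodgeTheory

namespace FermatCharacter

section ThirdConductor

variable {m : ℕ}

/-- `χ` vanishes at the primes of its level: `∏_{p ∣ f} (1 - χ(p)) = 1`. [folklore] -/
private theorem prod_primeFactors_one_sub_eq_one₃ {f : ℕ} (χ : DirichletCharacter ℂ f) :
    ∏ p ∈ f.primeFactors, (1 - χ (p : ZMod f)) = 1 := by
  refine Finset.prod_eq_one fun p hp ↦ ?_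
  have hpf : p ∣ f := Nat.dvd_of_mem_primeFactors hp
  have hp1 : p.Prime := Nat.prime_of_mem_primeFactors hp
  have hnu : ¬ IsUnit ((p : ℕ) : ZMod f) := by
    rw [ZMod.isUnit_iff_coprime]
    intro hc
    exact hp1.one_lt.ne' (Nat.Coprime.eq_one_of_dvd hc hpf)
  rw [χ.map_nonunit hnu, sub_zero]

/-- **[Aoki1983, Prop. 2.2] at a conductor `f`, `3 ∤ f`, met only at the exact levels `f`, `3f`.** Let
`α = (α₀, …, α_{r-1})` be a Hodge character of level `m`, `αᵢ = (m/Mᵢ) wᵢ` with `Mᵢ ∣ m` and `wᵢ` a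
unit mod `Mᵢ`, and let `f ∣ m` with `3 ∤ f` be such that every `Mᵢ` divisible by `f` is `f` or `3f`. Then
for every odd primitive character `χ` mod `f`:
`∑_{Mᵢ = 3f} (1 - χ(3)) (χ w̄ᵢ)⁻¹ + 2 ∑_{Mᵢ = f} (χ w̄ᵢ)⁻¹ = 0` (`w̄ᵢ = wᵢ mod f`; the weights are
`φ(m)/φ(3f) = c/2` and `φ(m)/φ(f) = c` since `φ(3f) = 2φ(f)` for `3 ∤ f`; the Euler factor of the level
`3f` is `1 - χ(3)`, that of the level `f` is `1`). [cite: Aoki1983, Prop. 2.2 with Prop. 2.1; §9 (V) pp. 52–54] -/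
theorem IsHodge.rel_third_conductor [NeZero m] {r : ℕ} {α : Fin r → ZMod m} (h : IsHodge α)
    {f : ℕ} [NeZero f] (h3 : ¬ 3 ∣ f) (hfm : f ∣ m) {χ : DirichletCharacter ℂ f} (hχ : χ.Odd)
    (hprim : χ.IsPrimitive) (M : Fin r → ℕ) [∀ i, NeZero (M i)] (hM : ∀ i, M i ∣ m)
    (w : (i : Fin r) → ZMod (M i)) (hw : ∀ i, IsUnit (w i))
    (hα : ∀ i, α i = ((m / M i : ℕ) : ZMod m) * ((ZMod.val (w i) : ℕ) : ZMod m))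
    (hlev : ∀ i, f ∣ M i → M i = f ∨ M i = 3 * f) :
    ∑ i, (if M i = 3 * f then (1 - χ 3) * (χ (ZMod.cast (w i) : ZMod f))⁻¹
      else if M i = f then 2 * (χ (ZMod.cast (w i) : ZMod f))⁻¹ else 0) = 0 := by
  classical
  have hm0 : m ≠ 0 := NeZero.ne m
  have hf0 : f ≠ 0 := NeZero.ne f
  have key := h.aoki_criterion hfm hχ hprim M hM w hw hα
  have hφf : ((f.totient : ℕ) : ℂ) ≠ 0 := by
    exact_mod_cast (Nat.totient_pos.mpr (Nat.pos_of_ne_zero hf0)).ne'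
  set c : ℂ := (m.totient : ℂ) / (f.totient : ℂ) with hc
  have hc0 : c ≠ 0 := div_ne_zero
    (by exact_mod_cast (Nat.totient_pos.mpr (Nat.pos_of_ne_zero hm0)).ne') hφf
  have hne13 : f ≠ 3 * f := by omega
  have hcop3 : Nat.Coprime 3 f := (Nat.Prime.coprime_iff_not_dvd Nat.prime_three).mpr h3
  have h3nmem : (3 : ℕ) ∉ f.primeFactors := fun h ↦ h3 (Nat.dvd_of_mem_primeFactors h)
  have hterm : ∀ i, (if f ∣ M i then ((m.totient : ℂ) / ((M i).totient : ℂ)) *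
        (∏ p ∈ (M i).primeFactors, (1 - χ p)) * (χ (ZMod.cast (w i) : ZMod f))⁻¹ else 0) =
      (c / 2) * (if M i = 3 * f then (1 - χ 3) * (χ (ZMod.cast (w i) : ZMod f))⁻¹
        else if M i = f then 2 * (χ (ZMod.cast (w i) : ZMod f))⁻¹ else 0) := by
    intro i
    by_cases hfi : f ∣ M i
    · rw [if_pos hfi]
      rcases hlev i hfi with h1 | h3'
      · -- exact level `f`
        have ht : ((M i).totient : ℂ) = f.totient := by rw [h1]
        have hp : ∏ p ∈ (M i).primeFactors, (1 - χ (p : ZMod f)) = 1 := by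
          rw [h1]; exact prod_primeFactors_one_sub_eq_one₃ χ
        rw [ht, hp, if_neg (by rw [h1]; exact hne13), if_pos h1, hc]
        ring
      · -- exact level `3f`
        have ht : ((M i).totient : ℂ) = 2 * f.totient := by
          rw [h3', Nat.totient_mul hcop3, show Nat.totient 3 = 2 by decide]; push_cast; ring
        have hp : ∏ p ∈ (M i).primeFactors, (1 - χ (p : ZMod f)) = 1 - χ 3 := by
          rw [h3', Nat.primeFactors_mul (by norm_num) hf0, Nat.prime_three.primeFactors,
            show ({3} ∪ f.primeFactors : Finset ℕ) = insert 3 f.primeFactors from rfl,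
            Finset.prod_insert h3nmem, prod_primeFactors_one_sub_eq_one₃ χ, mul_one, Nat.cast_ofNat]
        rw [ht, hp, if_pos h3', hc]
        field_simp
    · have hne3 : ¬ M i = 3 * f := fun h3' ↦ hfi (h3' ▸ dvd_mul_left f 3)
      have hne1 : ¬ M i = f := fun h1 ↦ hfi (h1 ▸ dvd_refl f)
      rw [if_neg hfi, if_neg hne3, if_neg hne1, mul_zero]
  rw [Finset.sum_congr rfl (fun i _ ↦ hterm i), ← Finset.mul_sum] at key
  exact (mul_eq_zero.mp key).resolve_left (div_ne_zero hc0 two_ne_zero)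

/-- **[Aoki1983, Prop. 2.2] at a conductor `f`, `3 ∤ f`, met at the exact levels `f`, `3f` — with character
values.** Under the hypotheses of `IsHodge.rel_third_conductor`:
`∑_{Mᵢ = 3f} (1 - conj χ(3)) χ(w̄ᵢ) + 2 ∑_{Mᵢ = f} χ(w̄ᵢ) = 0` for every odd primitive `χ` mod `f` (complex
conjugate of `rel_third_conductor`, `|χ(u)| = 1` on units): the points of level `3f` are `3`-twins
`w̄ᵢ, v₃w̄ᵢ` (`3v₃ = -1`, `χ(v₃) = -conj χ(3)`) of weight `1`, those of level `f` single points of weight `2` —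
Aoki's "`τ_{3d₀}(α)`". [cite: Aoki1983, Prop. 2.2; §9 (V) pp. 52–54] -/
theorem IsHodge.rel_third_conductor_conj [NeZero m] {r : ℕ} {α : Fin r → ZMod m} (h : IsHodge α)
    {f : ℕ} [NeZero f] (h3 : ¬ 3 ∣ f) (hfm : f ∣ m) {χ : DirichletCharacter ℂ f} (hχ : χ.Odd)
    (hprim : χ.IsPrimitive) (M : Fin r → ℕ) [∀ i, NeZero (M i)] (hM : ∀ i, M i ∣ m)
    (w : (i : Fin r) → ZMod (M i)) (hw : ∀ i, IsUnit (w i))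
    (hα : ∀ i, α i = ((m / M i : ℕ) : ZMod m) * ((ZMod.val (w i) : ℕ) : ZMod m))
    (hlev : ∀ i, f ∣ M i → M i = f ∨ M i = 3 * f) :
    ∑ i, (if M i = 3 * f then (1 - starRingEnd ℂ (χ 3)) * χ (ZMod.cast (w i) : ZMod f)
      else if M i = f then 2 * χ (ZMod.cast (w i) : ZMod f) else 0) = 0 := by
  classical
  have key := h.rel_third_conductor h3 hfm hχ hprim M hM w hw hα hlev
  -- conjugate: `(χ y)⁻¹ = conj (χ y)`
  have hinv : ∀ y : ZMod f, (χ y)⁻¹ = starRingEnd ℂ (χ y) := by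
    intro y
    by_cases hy : IsUnit y
    · exact Complex.inv_eq_conj (χ.unit_norm_eq_one hy.unit ▸ by rw [IsUnit.unit_spec])
    · rw [χ.map_nonunit hy, inv_zero, map_zero]
  have c2 : starRingEnd ℂ (2 : ℂ) = 2 := map_ofNat _ 2
  have hterm : ∀ i, (if M i = 3 * f then (1 - starRingEnd ℂ (χ 3)) * χ (ZMod.cast (w i) : ZMod f)
      else if M i = f then 2 * χ (ZMod.cast (w i) : ZMod f) else 0) =
      starRingEnd ℂ (if M i = 3 * f then (1 - χ 3) * (χ (ZMod.cast (w i) : ZMod f))⁻¹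
        else if M i = f then 2 * (χ (ZMod.cast (w i) : ZMod f))⁻¹ else 0) := by
    intro i
    by_cases h3' : M i = 3 * f
    · rw [if_pos h3', if_pos h3', map_mul, map_sub, map_one, map_inv₀, ← hinv 3,
        ← hinv (ZMod.cast (w i)), inv_inv]
    · by_cases h1 : M i = f
      · rw [if_neg h3', if_pos h1, if_neg h3', if_pos h1, map_mul, map_inv₀, c2, ← hinv, inv_inv]
      · rw [if_neg h3', if_neg h1, if_neg h3', if_neg h1, map_zero]
  rw [Finset.sum_congr rfl fun i _ ↦ hterm i, ← map_sum, key, map_zero]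

end ThirdConductor

end FermatCharacter

end Literature.AlgebraicGeometry.HodgeTheory
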